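import Mathlib
import Summits.QuantumFields.YangMills.Theorems.BalabanUVNodesN15BackgroundLayerFirstOrder
import HarnessLib

/-!
# Route «BalabanUVNodes» (cluster K4 «SpineRates»), Track-A DAG node N15 = spine estimate NE2, BACKGROUND LAYER — ENTRIES 2 AND 3 OF THE FIRST-ORDER
# BACKGROUND-DEPENDENT PAIR CONSTRUCTED: the `G∇*` entry as the source step over the stacked space (where the (3.44)-shaped `U ≡ 1` entry `∇_μG∇*` enters),
# the `ΔG` entry as a derived object of the stacked pair, and their η-defect majorants (general perturbation)

Cell `pub-ymgap`, seat `pub-ymgap-dag-n15-b` (generation g5; FIRST-MISSING-ESTIMATE, HUMAN RULING D-0062; chair R424 venue; ROSTER-D0062 l.26).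
`bears_on: R4∕N15`.  Filed `--supports stmt-QuantumFields-19676` (K3 `SpineGivenEndpointR11`, dag-lead RE-KEY word INBOX l.11920; helper).  Imports parts
B1a∕B1b∕B2 `…N15.BackgroundLayer` (`bgPropV`, `bgPair`, `stack`, `unstack`, `hasMaj_stack`, `hasMaj_unstack`, `hasMaj_idef_unstack`, `idef_stack`, `hasMaj_sandwichV`,
`hasMaj_idef_bgPropV`, `coeffBg₁`, `avg₁`), A3 (`poly0_le`, `bgConst1`) and g0's file 7 `…N15.BackgroundStep` (`idef_source_step_majorant`,
`idef_derived_entry_majorant_flat`) BY NAME; nothing in the tree is modified.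

THE POINT (ref-B READ-348: *«first missing estimate … first-order species ((3.44)-shaped sandwich entry)»*).  For the first-order pair `X̂ = (X, ∇_μX)_μ` of B1b,
the third (3.42) entry `X∇*` is the SOURCE STEP over the stacked space, `X̂∘Q = (1 − Ĝ∘V̂)⁻¹(Ĝ∘Q)` (`bgPropV_comp`): its `U ≡ 1` source is the STACK
`(G∇*, (∇_μG∇*)_μ)` — the `some μ` components are EXACTLY the printed (3.44)-SHAPED quantity *«|(∇_U G′∇*_U λ)(x)|»* ([Balaban1985BackgroundPropagators] p. 397),
which is where that entry enters the first-order background layer (not through a sandwich: the stacked device moved it into the `U ≡ 1` source).  The fourth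
entry `ΔX = ΔG + (ΔG)∘V∘X = ΔG + (ΔG∘V̂)∘X̂` is a derived object of the STACKED pair (g0 file 7's shape with the rectangular `X̂`; `comp_projO_none_bgPair`).

CONTENTS ([folklore]: linear algebra + the lineage's lemmas BY NAME; 2 defs).
* §1 `bgSourceV Ĝ Ŝ V̂ := ((1 − [Ĝ∘V̂])⁻¹·[Ŝ]).mulVecLin` (rectangular source step), `bgSourceV_fix`, `bgPropV_comp` (`X̂∘Q = bgSourceV Ĝ (Ĝ∘Q) V̂`), `bgDerivedV Ĝ D V̂ :=
  D + (D∘V̂)∘bgPropV Ĝ V̂`, `comp_projO_none_bgPair` (`P∘X = bgDerivedV Ĝ (P∘G) V̂` for the first-order pair: `ΔX` IS the derived object of `ΔG`).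
* §2 `hasMaj_bgSourceV`, `hasMaj_V_bgSourceV`, **`hasMaj_idef_bgSourceV`** (entry 2's η-defect, general perturbation: file 7 §1 with binders discharged; no
  majorant of `Ŝ′` needed), **`hasMaj_idef_bgDerivedV`** (entry 3's η-defect: file 7 §3 flat, the entry-0 defect from B1a).
* SEQUEL (part B4 `BalabanUVNodesN15BackgroundLayerFirstOrderFull`): the first-order pair under the guard (entries 2∕3 with the letters read off `coeffBg₁`'s
  `Reg335`) and `NE2PlusOperator` BY NAME with all four entries of the first-order pair constructed.

HONEST FRAMING ∕ LIMITS.  MECHANISM + linear algebra over hypothesis-shaped data; the `U ≡ 1` layer DISPLAYED — for entry 2 it now includes the (3.44)-shaped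
pieces `∇_μG∇*` at both spacings and their η-defect (inhabited on the unit torus only once the -a side types that piece's two-lattice rate: -a parts 12∕13 give
`∂H`, `H∂*`; the mixed `∂H∂*` piece is NOT in the tree — located, not claimed); scalar coefficients, linearised transport, sites of size `≥ 1`; nothing about
Bałaban's `G(U)` of [B6]∕[B9] asserted.  NE2⁺ NOT PRINTED, NOT proved; count-neutral (typed 28∕28; nothing discharged); N15 NOT discharged; one finite lattice at
fixed ε — NOT infinite volume, NOT OS on ℝ⁴, NOT a mass gap, NOT Clay.
-/

noncomputable section

namespace Summit.QuantumFields.YangMills.BalabanUVNodes.N15.BackgroundLayer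

open Literature.MathematicalPhysics.QuantumFieldTheory.Balaban1983to89
open Literature.MathematicalPhysics.QuantumFieldTheory.Balaban1983to89.B11SectG (BlockNorm HasMaj hasMaj_comp hasMaj_comp_exp RowSum)
open Literature.MathematicalPhysics.QuantumFieldTheory.Balaban1983to89.T4EtaRateDefect (idef slowWeight_const)
open Literature.MathematicalPhysics.QuantumFieldTheory.Balaban1983to89.T4EtaRateCoeffDefect (pull diagK diagK_nonneg FibreOsc blockAvg fit_blockAvg)
open Literature.MathematicalPhysics.QuantumFieldTheory.Balaban1983to89.B9SectDWeightedNeumann (WRow wrow_of_exp neumann_majorant_wrow)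
open Literature.MathematicalPhysics.QuantumFieldTheory.Balaban1983to89.B6RandomWalk (Triangle254)
open Literature.MathematicalPhysics.QuantumFieldTheory.Balaban1983to89.B9SectDSup (inv_one_sub_le_two)
open Summit.QuantumFields.YangMills.BalabanUVNodes.N15.DerivDefect (sum_mul_diagK sum_diagK_mul exists_const_hasMaj_ofBlocks)
open Summit.QuantumFields.YangMills.BalabanUVNodes.N15.BackgroundModel (kappa_ofBlocks)
open Summit.QuantumFields.YangMills.BalabanUVNodes.N15.BackgroundStep (idef_source_step_majorant idef_derived_entry_majorant_flat)

/-! ## §1 The rectangular source step and the derived object, with their interpretation -/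

section Objects

variable {X X₂ : Type} [Fintype X] [Fintype X₂] [DecidableEq X] [DecidableEq X₂]

/-- THE SOURCE STEP OVER THE STACKED SPACE `Z = (1 − Ĝ∘V̂)⁻¹Ŝ` with a rectangular `U ≡ 1` source `Ŝ` (intended: the stack `(G∇*, (∇_μG∇*)_μ)`) — entry 2's object.
[cite: Balaban1985BackgroundPropagators, (3.64)–(3.65) pp.402–403 (shape)] -/
def bgSourceV (G S : (X → ℝ) →ₗ[ℝ] (X₂ → ℝ)) (V : (X₂ → ℝ) →ₗ[ℝ] (X → ℝ)) : (X → ℝ) →ₗ[ℝ] (X₂ → ℝ) :=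
  ((1 - LinearMap.toMatrix' (G ∘ₗ V))⁻¹ * LinearMap.toMatrix' S).mulVecLin

/-- (3.65) with the source `Ŝ`, BY CONSTRUCTION: `Z = Ŝ + (Ĝ∘V̂)∘Z`. [cite: Balaban1985BackgroundPropagators, (3.65) p.403 (shape)] -/
theorem bgSourceV_fix {G S : (X → ℝ) →ₗ[ℝ] (X₂ → ℝ)} {V : (X₂ → ℝ) →ₗ[ℝ] (X → ℝ)} (hunit : IsUnit (1 - LinearMap.toMatrix' (G ∘ₗ V))) :
    bgSourceV G S V = S + (G ∘ₗ V) ∘ₗ bgSourceV G S V := by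
  set T := LinearMap.toMatrix' (G ∘ₗ V) with hT
  set K := LinearMap.toMatrix' S with hK
  have h : (1 - T) * ((1 - T)⁻¹ * K) = K := by
    rw [← Matrix.mul_assoc, Matrix.mul_nonsing_inv _ ((Matrix.isUnit_iff_isUnit_det _).1 hunit), Matrix.one_mul]
  rw [Matrix.sub_mul, Matrix.one_mul, sub_eq_iff_eq_add] at h
  unfold bgSourceV
  rw [← hT, ← hK]
  conv_lhs => rw [h]
  rw [Matrix.mulVecLin_add, Matrix.mulVecLin_mul, hT, hK, mulVecLin_toMatrix', mulVecLin_toMatrix'_rect]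

/-- INTERPRETATION: `X̂∘Q` IS the source step with source `Ĝ∘Q` (so `(X∇*, ∇_μX∇*)_μ = (1 − Ĝ∘V̂)⁻¹(G∇*, ∇_μG∇*)_μ`). [folklore] -/
theorem bgPropV_comp (G : (X → ℝ) →ₗ[ℝ] (X₂ → ℝ)) (V : (X₂ → ℝ) →ₗ[ℝ] (X → ℝ)) (Q : (X → ℝ) →ₗ[ℝ] (X → ℝ)) :
    bgPropV G V ∘ₗ Q = bgSourceV G (G ∘ₗ Q) V := by
  unfold bgPropV bgSourceV
  conv_lhs => rw [← mulVecLin_toMatrix' Q]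
  rw [← Matrix.mulVecLin_mul, LinearMap.toMatrix'_comp G Q, Matrix.mul_assoc]

/-- THE DERIVED OBJECT `Y = D + (D∘V̂)∘X̂` of a `U ≡ 1` derived piece `D` (intended: `ΔG`) over the stacked propagator — entry 3's object.
[cite: King1986, Prop. 3.9 (3.73) p.665 (separate kernel: shape)] -/
def bgDerivedV (G : (X → ℝ) →ₗ[ℝ] (X₂ → ℝ)) (D : (X → ℝ) →ₗ[ℝ] (X → ℝ)) (V : (X₂ → ℝ) →ₗ[ℝ] (X → ℝ)) : (X → ℝ) →ₗ[ℝ] (X → ℝ) :=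
  D + (D ∘ₗ V) ∘ₗ bgPropV G V

end Objects

section Interpretation

variable {X J : Type} [Fintype X] [Fintype J] [DecidableEq X] [DecidableEq J] {G : (X → ℝ) →ₗ[ℝ] (X → ℝ)} {D : J → (X → ℝ) →ₗ[ℝ] (X → ℝ)}
  {c : X → ℝ} {a : J → X → ℝ}

/-- INTERPRETATION for the first-order pair: `P∘X = bgDerivedV Ĝ (P∘G) V̂` with `X` the propagator component — `ΔX` IS the derived object of `ΔG`, by (3.65).
[folklore] -/
theorem comp_projO_none_bgPair (hunit : IsUnit (1 - LinearMap.toMatrix' (stack G D ∘ₗ unstack c a))) (P : (X → ℝ) →ₗ[ℝ] (X → ℝ)) :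
    P ∘ₗ (projO none ∘ₗ bgPair G D c a) = bgDerivedV (stack G D) (P ∘ₗ G) (unstack c a) := by
  unfold bgDerivedV
  rw [projO_none_bgPair hunit, LinearMap.comp_add]
  rfl

end Interpretation

/-! ## §2 Majorants: the source step and the derived object, general perturbation -/

section Majorants

variable {X X₂ X' X₂' : Type} [Fintype X] [Fintype X₂] [Fintype X'] [Fintype X₂'] [DecidableEq X] [DecidableEq X₂] [DecidableEq X']
  [DecidableEq X₂'] {g : B6.Geometry} (blk : X → g.Site) (blk₂ : X₂ → g.Site) (π : X' → X) (π₂ : X₂' → X₂)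
variable {β δ R σ cr : ℝ}

/-- NEUMANN WITH DECAY FOR ANY RECTANGULAR SOURCE `Ŝ ≤ β·e^{−δd}`: `bgSourceV Ĝ Ŝ V̂ ≤ β(1 − βRc_r)⁻¹·e^{−ρd}`. [cite: Balaban1985BackgroundPropagators, (3.64) p.403 (mechanism); Balaban1984PropagatorsII, (2.52)–(2.56) pp.232–233] -/
theorem hasMaj_bgSourceV (htri : Triangle254 g) (hd : ∀ a b : g.Site, 0 ≤ g.dist a b) (hrow : RowSum g σ cr) (hσ : 0 ≤ σ) {ρ : ℝ} (hρ : 0 ≤ ρ)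
    (hρδ : ρ + σ ≤ δ) (hβ : 0 ≤ β) (hR : 0 ≤ R) {G S : (X → ℝ) →ₗ[ℝ] (X₂ → ℝ)} {V : (X₂ → ℝ) →ₗ[ℝ] (X → ℝ)}
    (hG : HasMaj (BlockNorm.ofBlocks g blk) (BlockNorm.ofBlocks g blk₂) G (fun y y' => β * Real.exp (-(δ * g.dist y y'))))
    (hS : HasMaj (BlockNorm.ofBlocks g blk) (BlockNorm.ofBlocks g blk₂) S (fun y y' => β * Real.exp (-(δ * g.dist y y'))))
    (hV : HasMaj (BlockNorm.ofBlocks g blk₂) (BlockNorm.ofBlocks g blk) V (diagK fun _ => R)) (hq : β * R * cr < 1) :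
    HasMaj (BlockNorm.ofBlocks g blk) (BlockNorm.ofBlocks g blk₂) (bgSourceV G S V)
      (fun y y' => β * (1 - β * R * cr)⁻¹ * Real.exp (-(ρ * g.dist y y'))) := by
  have hσδ : σ ≤ δ := by linarith
  have hfix := bgSourceV_fix (S := S) (isUnit_stepV blk blk₂ hd hrow hσδ hβ hR hG hV hq)
  have hK := hasMaj_stepV blk blk₂ hβ hG hV
  have hwrow : WRow g ρ (fun y y' => β * R * Real.exp (-(δ * g.dist y y'))) (β * R * cr) := wrow_of_exp hd hrow (mul_nonneg hβ hR) hρδ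
  have hS' : HasMaj (BlockNorm.ofBlocks g blk) (BlockNorm.ofBlocks g blk₂) S (fun y y' => β * Real.exp (-(ρ * g.dist y y'))) :=
    hS.mono fun a b => mul_le_mul_of_nonneg_left (Real.exp_le_exp.mpr (by nlinarith [hd a b])) hβ
  obtain ⟨M₀, hM₀, hap⟩ := exists_const_hasMaj_ofBlocks (g := g) blk blk₂ (bgSourceV G S V)
  have hq1 : (BlockNorm.ofBlocks g blk₂).κ * (β * R * cr) < 1 := by rw [kappa_ofBlocks, one_mul]; exact hq
  have key := neumann_majorant_wrow htri hd hρ (fun _ _ => mul_nonneg (mul_nonneg hβ hR) (Real.exp_nonneg _)) hwrow hβ hM₀ hK hS' hfix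
    hap hq1
  refine key.mono fun a b => le_of_eq ?_
  rw [kappa_ofBlocks, one_mul]

/-- The coarse `V̂∘Z ≤ R·β(1 − q)⁻¹·e^{−ρd}`. [cite: Balaban1985BackgroundPropagators, (3.63) p.402 (shape)] -/
theorem hasMaj_V_bgSourceV (htri : Triangle254 g) (hd : ∀ a b : g.Site, 0 ≤ g.dist a b) (hrow : RowSum g σ cr) (hσ : 0 ≤ σ) {ρ : ℝ} (hρ : 0 ≤ ρ)
    (hρδ : ρ + σ ≤ δ) (hβ : 0 ≤ β) (hR : 0 ≤ R) {G S : (X → ℝ) →ₗ[ℝ] (X₂ → ℝ)} {V : (X₂ → ℝ) →ₗ[ℝ] (X → ℝ)}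
    (hG : HasMaj (BlockNorm.ofBlocks g blk) (BlockNorm.ofBlocks g blk₂) G (fun y y' => β * Real.exp (-(δ * g.dist y y'))))
    (hS : HasMaj (BlockNorm.ofBlocks g blk) (BlockNorm.ofBlocks g blk₂) S (fun y y' => β * Real.exp (-(δ * g.dist y y'))))
    (hV : HasMaj (BlockNorm.ofBlocks g blk₂) (BlockNorm.ofBlocks g blk) V (diagK fun _ => R)) (hq : β * R * cr < 1) :
    HasMaj (BlockNorm.ofBlocks g blk) (BlockNorm.ofBlocks g blk) (V ∘ₗ bgSourceV G S V)
      (fun y y' => R * (β * (1 - β * R * cr)⁻¹) * Real.exp (-(ρ * g.dist y y'))) := by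
  have hZ := hasMaj_bgSourceV blk blk₂ htri hd hrow hσ hρ hρδ hβ hR hG hS hV hq
  have key := hasMaj_comp hV hZ (fun _ _ => diagK_nonneg (fun _ => hR) _ _)
  refine key.mono fun a b => le_of_eq ?_
  rw [kappa_ofBlocks]
  simp only [one_mul]
  rw [sum_diagK_mul]
  ring

/-- **ENTRY 2 — THE η-DEFECT OF THE RECTANGULAR SOURCE STEP.**  B1a's data (`Ĝ, Ĝ′ ≤ β·e^{−δd}`, `𝔇(Ĝ′,Ĝ) ≤ m_G·e^{−δd}`, `V̂, V̂′ ≤ diagK R`, `𝔇(V̂′,V̂) ≤ diagK o`,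
`q = βRc_r < 1`) plus a `U ≡ 1` source pair with `Ŝ ≤ β·e^{−δd}` and `𝔇(Ŝ′, Ŝ) ≤ m_S·e^{−δd}` (no majorant of `Ŝ′` needed):
`𝔇(bgSourceV Ĝ′ Ŝ′ V̂′, bgSourceV Ĝ Ŝ V̂) ≤ (m_S c_r + m_G c_r·(Rβ(1−q)⁻¹) + β·o·β(1−q)⁻¹·c_r)(1−q)⁻¹·e^{−ρd}`. [cite: Balaban1985BackgroundPropagators, Thm 3.1 (3.42) + (3.44) p.397 (entries: shapes); (3.63)–(3.65) pp.402–403 (mechanism)] -/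
theorem hasMaj_idef_bgSourceV (htri : Triangle254 g) (hd : ∀ a b : g.Site, 0 ≤ g.dist a b) (hσ : 0 ≤ σ) (hcr : 0 ≤ cr) (hrow : RowSum g σ cr)
    {ρ o mG mS : ℝ} (hρ : 0 ≤ ρ) (hρδ : ρ + σ ≤ δ) (hβ : 0 ≤ β) (hR : 0 ≤ R) (ho : 0 ≤ o) (hmG : 0 ≤ mG) (hmS : 0 ≤ mS)
    {G S : (X → ℝ) →ₗ[ℝ] (X₂ → ℝ)} {V : (X₂ → ℝ) →ₗ[ℝ] (X → ℝ)} {G' S' : (X' → ℝ) →ₗ[ℝ] (X₂' → ℝ)} {V' : (X₂' → ℝ) →ₗ[ℝ] (X' → ℝ)}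
    (hG : HasMaj (BlockNorm.ofBlocks g blk) (BlockNorm.ofBlocks g blk₂) G (fun y y' => β * Real.exp (-(δ * g.dist y y'))))
    (hG' : HasMaj (BlockNorm.ofBlocks g (blk ∘ π)) (BlockNorm.ofBlocks g (blk₂ ∘ π₂)) G' (fun y y' => β * Real.exp (-(δ * g.dist y y'))))
    (hS : HasMaj (BlockNorm.ofBlocks g blk) (BlockNorm.ofBlocks g blk₂) S (fun y y' => β * Real.exp (-(δ * g.dist y y'))))
    (hDG : HasMaj (BlockNorm.ofBlocks g blk) (BlockNorm.ofBlocks g (blk₂ ∘ π₂)) (idef (pull π) (pull π₂) G' G)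
      (fun y y' => mG * Real.exp (-(δ * g.dist y y'))))
    (hDS : HasMaj (BlockNorm.ofBlocks g blk) (BlockNorm.ofBlocks g (blk₂ ∘ π₂)) (idef (pull π) (pull π₂) S' S)
      (fun y y' => mS * Real.exp (-(δ * g.dist y y'))))
    (hV : HasMaj (BlockNorm.ofBlocks g blk₂) (BlockNorm.ofBlocks g blk) V (diagK fun _ => R))
    (hV' : HasMaj (BlockNorm.ofBlocks g (blk₂ ∘ π₂)) (BlockNorm.ofBlocks g (blk ∘ π)) V' (diagK fun _ => R))
    (hDV : HasMaj (BlockNorm.ofBlocks g blk₂) (BlockNorm.ofBlocks g (blk ∘ π)) (idef (pull π₂) (pull π) V' V) (diagK fun _ => o))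
    (hq : β * R * cr < 1) :
    HasMaj (BlockNorm.ofBlocks g blk) (BlockNorm.ofBlocks g (blk₂ ∘ π₂)) (idef (pull π) (pull π₂) (bgSourceV G' S' V') (bgSourceV G S V))
      (fun y y' => (mS * cr + 1 * (mG * cr) * (R * (β * (1 - β * R * cr)⁻¹)) * 1 + β * o * (β * (1 - β * R * cr)⁻¹) * cr) *
        (1 - 1 * (β * R * cr))⁻¹ * Real.exp (-(ρ * g.dist y y')) * 1) := by
  have hσδ : σ ≤ δ := by linarith
  have hq' : 0 < 1 - β * R * cr := by linarith
  have hAX : 0 ≤ β * (1 - β * R * cr)⁻¹ := mul_nonneg hβ (inv_nonneg.2 hq'.le)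
  have hfix := bgSourceV_fix (S := S) (isUnit_stepV blk blk₂ hd hrow hσδ hβ hR hG hV hq)
  have hfix' := bgSourceV_fix (S := S') (isUnit_stepV (blk ∘ π) (blk₂ ∘ π₂) hd hrow hσδ hβ hR hG' hV' hq)
  have hK' := hasMaj_stepV (blk ∘ π) (blk₂ ∘ π₂) hβ hG' hV'
  have hwrow' : WRow g ρ (fun y y' => β * R * Real.exp (-(δ * g.dist y y'))) (β * R * cr) := wrow_of_exp hd hrow (mul_nonneg hβ hR) hρδ
  have hwrowG : WRow g ρ (fun y y' => mG * Real.exp (-(δ * g.dist y y'))) (mG * cr) := wrow_of_exp hd hrow hmG hρδ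
  have hwrowS : WRow g ρ (fun y y' => mS * Real.exp (-(δ * g.dist y y'))) (mS * cr) := wrow_of_exp hd hrow hmS hρδ
  have hVX := hasMaj_V_bgSourceV blk blk₂ htri hd hrow hσ hρ hρδ hβ hR hG hS hV hq
  have hZ := hasMaj_bgSourceV blk blk₂ htri hd hrow hσ hρ hρδ hβ hR hG hS hV hq
  have hDVs := hasMaj_sandwichV blk blk₂ π π₂ htri hd hrow hρ hρδ hβ hAX ho hG' hZ hDV
  obtain ⟨M₀, hM₀, hap⟩ := exists_const_hasMaj_ofBlocks (g := g) blk (blk₂ ∘ π₂)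
    (idef (pull π) (pull π₂) (bgSourceV G' S' V') (bgSourceV G S V))
  have hq2 : (BlockNorm.ofBlocks g (blk₂ ∘ π₂)).κ * (β * R * cr) < 1 := by rw [kappa_ofBlocks, one_mul]; exact hq
  have key := idef_source_step_majorant (b₁ := BlockNorm.ofBlocks g blk) (b₂' := BlockNorm.ofBlocks g (blk₂ ∘ π₂))
    (τ₁ := pull π) (τ₂ := pull π₂) (S := S) (G₁ := G) (Xc := bgSourceV G S V) (V := V) (S' := S') (G₁' := G')
    (Xf := bgSourceV G' S' V') (V' := V') (w := fun _ => (1 : ℝ)) (ρ := ρ) (σ := 0) (C := 1) htri hd hρ (fun _ => zero_le_one)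
    (slowWeight_const 1) zero_le_one (mul_nonneg hR hAX) (mul_nonneg (mul_nonneg (mul_nonneg hβ ho) hAX) hcr) hM₀
    (fun _ _ => mul_nonneg (mul_nonneg hβ hR) (Real.exp_nonneg _)) hwrow' (fun _ _ => mul_nonneg hmS (Real.exp_nonneg _)) hwrowS
    (fun _ _ => mul_nonneg hmG (Real.exp_nonneg _)) hwrowG hfix hfix' hK' (by simpa only [add_zero] using hVX)
    (by simpa only [mul_one] using hDS) (by simpa only [mul_one] using hDG) (by simpa only [mul_one] using hDVs) (by simpa only [mul_one] using hap) hq2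
  refine key.mono fun a b => le_of_eq ?_
  rfl

omit [Fintype X₂'] [DecidableEq X] [DecidableEq X₂] [DecidableEq X'] [DecidableEq X₂'] in
/-- BINDER (d) WITH A LEFT FACTOR OF ARBITRARY TARGET: for `G′ : (X′ → ℝ) → (X₃′ → ℝ)` with `G′ ≤ β·e^{−δd}` into blocks `blk₃′`, a coarse `Xc ≤ A·e^{−ρd}` into the
stacked target and a diagonal perturbation defect `𝔇(V̂′, V̂) ≤ diagK o`: `G′ ∘ 𝔇(V̂′, V̂) ∘ Xc ≤ β·o·A·c_r·e^{−ρd}` (B1a `hasMaj_sandwichV` is the case `X₃′ = X₂′`).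
[folklore] -/
theorem hasMaj_sandwichV₃ {X₃' : Type} [Fintype X₃'] (blk₃' : X₃' → g.Site) (htri : Triangle254 g) (hd : ∀ a b : g.Site, 0 ≤ g.dist a b)
    (hrow : RowSum g σ cr) {ρ A o : ℝ} (hρ : 0 ≤ ρ) (hρδ : ρ + σ ≤ δ) (hβ : 0 ≤ β) (hA : 0 ≤ A) (ho : 0 ≤ o)
    {G' : (X' → ℝ) →ₗ[ℝ] (X₃' → ℝ)} {V' : (X₂' → ℝ) →ₗ[ℝ] (X' → ℝ)} {V : (X₂ → ℝ) →ₗ[ℝ] (X → ℝ)} {Xc : (X → ℝ) →ₗ[ℝ] (X₂ → ℝ)}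
    (hG' : HasMaj (BlockNorm.ofBlocks g (blk ∘ π)) (BlockNorm.ofBlocks g blk₃') G' (fun y y' => β * Real.exp (-(δ * g.dist y y'))))
    (hXc : HasMaj (BlockNorm.ofBlocks g blk) (BlockNorm.ofBlocks g blk₂) Xc (fun y y' => A * Real.exp (-(ρ * g.dist y y'))))
    (hDV : HasMaj (BlockNorm.ofBlocks g blk₂) (BlockNorm.ofBlocks g (blk ∘ π)) (idef (pull π₂) (pull π) V' V) (diagK fun _ => o)) :
    HasMaj (BlockNorm.ofBlocks g blk) (BlockNorm.ofBlocks g blk₃') (G' ∘ₗ idef (pull π₂) (pull π) V' V ∘ₗ Xc)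
      (fun y y' => β * o * A * cr * Real.exp (-(ρ * g.dist y y'))) := by
  have h1 := hasMaj_comp hG' hDV (fun _ _ => mul_nonneg hβ (Real.exp_nonneg _))
  have h1' : HasMaj (BlockNorm.ofBlocks g blk₂) (BlockNorm.ofBlocks g blk₃') (G' ∘ₗ idef (pull π₂) (pull π) V' V)
      (fun y y' => β * o * Real.exp (-(δ * g.dist y y'))) := by
    refine h1.mono fun a b => le_of_eq ?_
    rw [kappa_ofBlocks]
    simp only [one_mul]
    rw [sum_mul_diagK]
    ring
  have h2 := hasMaj_comp_exp (b₁ := BlockNorm.ofBlocks g blk) (b₂ := BlockNorm.ofBlocks g blk₂) (b₃ := BlockNorm.ofBlocks g blk₃')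
    htri hd hrow (mul_nonneg hβ ho) hA hρ le_rfl hρδ h1' hXc
  have hop : G' ∘ₗ idef (pull π₂) (pull π) V' V ∘ₗ Xc = (G' ∘ₗ idef (pull π₂) (pull π) V' V) ∘ₗ Xc := rfl
  rw [hop]
  refine h2.mono fun a b => le_of_eq ?_
  rw [kappa_ofBlocks]
  ring

/-- **ENTRY 3 — THE η-DEFECT OF THE DERIVED OBJECT OVER THE STACKED PROPAGATOR.**  B1a's data plus a `U ≡ 1` derived pair `D, D′` (targets = the base lattices)
with `D′ ≤ β·e^{−δd}` and `𝔇(D′, D) ≤ m_D·e^{−δd}`: `𝔇(bgDerivedV Ĝ′ D′ V̂′, bgDerivedV Ĝ D V̂) ≤ (m_D c_r + m_D c_r·(Rβ(1−q)⁻¹) + βRc_r·c_X + β·o·β(1−q)⁻¹·c_r)·e^{−ρd}`,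
`c_X` = B1a's entry-0 constant. [cite: Balaban1985BackgroundPropagators, Thm 3.1 (3.42) p.397 (fourth entry: shape); King1986, Prop. 3.9 (3.73) p.665 (shape)] -/
theorem hasMaj_idef_bgDerivedV (htri : Triangle254 g) (hd : ∀ a b : g.Site, 0 ≤ g.dist a b) (hσ : 0 ≤ σ) (hcr : 0 ≤ cr) (hrow : RowSum g σ cr)
    {ρ o mG mD : ℝ} (hρ : 0 ≤ ρ) (hρδ : ρ + σ ≤ δ) (hβ : 0 ≤ β) (hR : 0 ≤ R) (ho : 0 ≤ o) (hmG : 0 ≤ mG) (hmD : 0 ≤ mD)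
    {G : (X → ℝ) →ₗ[ℝ] (X₂ → ℝ)} {V : (X₂ → ℝ) →ₗ[ℝ] (X → ℝ)} {G' : (X' → ℝ) →ₗ[ℝ] (X₂' → ℝ)} {V' : (X₂' → ℝ) →ₗ[ℝ] (X' → ℝ)}
    {D : (X → ℝ) →ₗ[ℝ] (X → ℝ)} {D' : (X' → ℝ) →ₗ[ℝ] (X' → ℝ)}
    (hG : HasMaj (BlockNorm.ofBlocks g blk) (BlockNorm.ofBlocks g blk₂) G (fun y y' => β * Real.exp (-(δ * g.dist y y'))))
    (hG' : HasMaj (BlockNorm.ofBlocks g (blk ∘ π)) (BlockNorm.ofBlocks g (blk₂ ∘ π₂)) G' (fun y y' => β * Real.exp (-(δ * g.dist y y'))))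
    (hD' : HasMaj (BlockNorm.ofBlocks g (blk ∘ π)) (BlockNorm.ofBlocks g (blk ∘ π)) D' (fun y y' => β * Real.exp (-(δ * g.dist y y'))))
    (hDG : HasMaj (BlockNorm.ofBlocks g blk) (BlockNorm.ofBlocks g (blk₂ ∘ π₂)) (idef (pull π) (pull π₂) G' G)
      (fun y y' => mG * Real.exp (-(δ * g.dist y y'))))
    (hDD : HasMaj (BlockNorm.ofBlocks g blk) (BlockNorm.ofBlocks g (blk ∘ π)) (idef (pull π) (pull π) D' D)
      (fun y y' => mD * Real.exp (-(δ * g.dist y y'))))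
    (hV : HasMaj (BlockNorm.ofBlocks g blk₂) (BlockNorm.ofBlocks g blk) V (diagK fun _ => R))
    (hV' : HasMaj (BlockNorm.ofBlocks g (blk₂ ∘ π₂)) (BlockNorm.ofBlocks g (blk ∘ π)) V' (diagK fun _ => R))
    (hDV : HasMaj (BlockNorm.ofBlocks g blk₂) (BlockNorm.ofBlocks g (blk ∘ π)) (idef (pull π₂) (pull π) V' V) (diagK fun _ => o))
    (hq : β * R * cr < 1) :
    HasMaj (BlockNorm.ofBlocks g blk) (BlockNorm.ofBlocks g (blk ∘ π)) (idef (pull π) (pull π) (bgDerivedV G' D' V') (bgDerivedV G D V))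
      (fun y y' => (mD * cr + 1 * (mD * cr) * (R * (β * (1 - β * R * cr)⁻¹)) +
          1 * (β * R * cr) * ((mG * cr + 1 * (mG * cr) * (R * (β * (1 - β * R * cr)⁻¹)) + β * o * (β * (1 - β * R * cr)⁻¹) * cr) *
            (1 - 1 * (β * R * cr))⁻¹) + β * o * (β * (1 - β * R * cr)⁻¹) * cr) * Real.exp (-(ρ * g.dist y y'))) := by
  have hσδ : σ ≤ δ := by linarith
  have hq' : 0 < 1 - β * R * cr := by linarith
  have hAX : 0 ≤ β * (1 - β * R * cr)⁻¹ := mul_nonneg hβ (inv_nonneg.2 hq'.le)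
  have hwrowD : WRow g ρ (fun y y' => mD * Real.exp (-(δ * g.dist y y'))) (mD * cr) := wrow_of_exp hd hrow hmD hρδ
  have hDV' : HasMaj (BlockNorm.ofBlocks g (blk₂ ∘ π₂)) (BlockNorm.ofBlocks g (blk ∘ π)) (D' ∘ₗ V')
      (fun y y' => β * R * Real.exp (-(δ * g.dist y y'))) := by
    have key := hasMaj_comp hD' hV' (fun _ _ => mul_nonneg hβ (Real.exp_nonneg _))
    refine key.mono fun a b => le_of_eq ?_
    rw [kappa_ofBlocks]
    simp only [one_mul]
    rw [sum_mul_diagK]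
    ring
  have hwrow' : WRow g ρ (fun y y' => β * R * Real.exp (-(δ * g.dist y y'))) (β * R * cr) := wrow_of_exp hd hrow (mul_nonneg hβ hR) hρδ
  have hVX := hasMaj_V_bgPropV blk blk₂ htri hd hrow hσ hρ hρδ hβ hR hG hV hq
  have hX := hasMaj_bgPropV blk blk₂ htri hd hrow hσ hρ hρδ hβ hR hG hV hq
  have hDX := hasMaj_idef_bgPropV blk blk₂ π π₂ htri hd hσ hcr hrow hρ hρδ hβ hR ho hmG hG hG' hDG hV hV' hDV hq
  have hsand := hasMaj_sandwichV₃ blk blk₂ π π₂ (blk ∘ π) htri hd hrow hρ hρδ hβ hAX ho hD' hX hDV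
  have hcX : 0 ≤ (mG * cr + 1 * (mG * cr) * (R * (β * (1 - β * R * cr)⁻¹)) + β * o * (β * (1 - β * R * cr)⁻¹) * cr) *
      (1 - 1 * (β * R * cr))⁻¹ := by
    have h1 : 0 ≤ (1 - 1 * (β * R * cr))⁻¹ := inv_nonneg.2 (by linarith)
    have h2 : 0 ≤ (1 - β * R * cr)⁻¹ := inv_nonneg.2 hq'.le
    positivity
  have key := idef_derived_entry_majorant_flat (b₁ := BlockNorm.ofBlocks g blk) (b₂' := BlockNorm.ofBlocks g (blk₂ ∘ π₂))
    (b₃' := BlockNorm.ofBlocks g (blk ∘ π)) (pull π) (pull π₂) (pull π) (D₁ := D) (Y := bgDerivedV G D V) (V := V) (Xc := bgPropV G V) (D₁' := D')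
    (Y' := bgDerivedV G' D' V') (V' := V') (Xf := bgPropV G' V') (ρ := ρ) htri hρ (mul_nonneg hR hAX) hcX
    (fun _ _ => mul_nonneg hmD (Real.exp_nonneg _)) hwrowD (fun _ _ => mul_nonneg (mul_nonneg hβ hR) (Real.exp_nonneg _)) hwrow' rfl rfl hDD hVX
    hDV' hDX hsand
  refine key.mono fun a b => le_of_eq ?_
  rfl

end Majorants

end Summit.QuantumFields.YangMills.BalabanUVNodes.N15.BackgroundLayer
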